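import Literature.Computability.QuantumComplexity.HadamardGadgetFamily
import HarnessLib

/-!
# The Hadamard gadget, IV: the padded circuit and the closed form of its gadget operations

Topic `Literature/Computability/QuantumComplexity`; sequel of `HadamardGadgetFamily.lean`
(Bremner–Jozsa–Shepherd 2011, proof of Thm. 1, arXiv:1005.1407 p. 7). The uniformity of the
gadget family — the half of `PostBQPWith_subset_PostIQPWith` left open there — asks for a
polynomial-time machine printing the gadget's IQP circuit from the description of `F.circ n`. The
gadget rewriting `HGadget.run` keeps a table of current variables, one per wire, updated at every
`H`; a description printer would have to maintain that table. This file removes the table by a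
harmless change of the *circuit*: after every gate of `C` two full layers of Hadamard gates are
inserted (`HGadget.padCirc C`; `H H = 1` on every line, so `U_{padCirc C} = U_C`,
`padCirc_toMatrix`, and all post-selected probabilities are unchanged, `postselectProbOn_padFamily`
etc.). In the rewriting of the sandwich of the padded circuit every line is "teleported" after
every gate, so that **before the slot of gate `t` the current variable of wire `a` is `k_t + a`**,
`k_t` the number of variables allocated so far (`HGadget.Based`); the operations emitted in a slot
are an explicit function `HGadget.slotOps N k g` of the counter `k` and the gate `g` alone, and

* `ops_sfinal_padCirc`: the operations of the gadget rewriting of `sandwich (padCirc C)` are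
  `initOps N ++ padOpsFrom N N C.gates ++ lastOps N K₁` (closed form, slot by slot),
* `preCount_padCirc`: `K₁ = padKFrom N N C.gates = N + Σ_t (extra g_t + 2N)`,

which is the list a single left-to-right pass over the gate codes with one counter prints (the
subject of the sequel files). Consequently (`PostBQPWith_subset_PostIQPWith_of_padGadgetUniform`)
the named fact follows from the uniformity of `gadgetFamily (padFamily F)` for uniform oracle-free
`F`.

## References

* M. J. Bremner, R. Jozsa, D. J. Shepherd, Proc. R. Soc. A 467 (2011) 459–472, arXiv:1005.1407:
  §2.3 ("by inserting two `H`'s on each line between each pair of gates, recalling that `HH = I`"),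
  Thm. 1 (proof, Fig. 1), p. 7.
* S. Arora, B. Barak, *Computational Complexity: A Modern Approach*, CUP 2009, Remark 6.7
  (descriptions of regular circuit families are printed with counters).
-/

noncomputable section

namespace Literature.Computability.QuantumComplexity

open _root_.Computability Complexity Cryptography Matrix

namespace HGadget

variable {N : ℕ}

/-! ### The padded circuit -/

/-- The gates of `C` with two full Hadamard layers inserted after every gate (BJS 2011, §2.3:
"inserting two `H`'s on each line between each pair of gates, recalling that `HH = I`").
[cite: BremnerJozsaShepherdPRSA2011, §2.3] -/
def padGates (gs : List (QGate cliffordT N)) : List (QGate cliffordT N) :=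
  gs.flatMap fun g => g :: (hLayerGates N ++ hLayerGates N)

/-- The padded circuit. [cite: BremnerJozsaShepherdPRSA2011, §2.3] -/
def padCirc (C : QCircuit cliffordT N) : QCircuit cliffordT N := ⟨padGates C.gates⟩

/-- `padGates` on a cons. [folklore] -/
theorem padGates_cons (g : QGate cliffordT N) (gs : List (QGate cliffordT N)) :
    padGates (g :: gs) = g :: (hLayerGates N ++ hLayerGates N) ++ padGates gs := by
  simp [padGates]

/-- Two Hadamard layers are the identity: `H^{⊗N} H^{⊗N} = 1`. [cite: NielsenChuang2010, Exercise 2.33 eq. (2.55)] -/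
theorem gmat_hLayerGates_append_hLayerGates : gmat (hLayerGates N ++ hLayerGates N) = 1 := by
  rw [gmat_append, gmat_hLayerGates, hGateAll_mul_self]

/-- **Padding does not change the matrix.** [cite: BremnerJozsaShepherdPRSA2011, §2.3] -/
theorem gmat_padGates (gs : List (QGate cliffordT N)) : gmat (padGates gs) = gmat gs := by
  induction gs with
  | nil => rfl
  | cons g gs ih =>
    rw [padGates_cons, gmat_append, ih, show g :: (hLayerGates N ++ hLayerGates N) =
      [g] ++ (hLayerGates N ++ hLayerGates N) from rfl, gmat_append,
      gmat_hLayerGates_append_hLayerGates, Matrix.one_mul]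
    simp [gmat, QCircuit.toMatrix_cons]

/-- The padded circuit computes the same unitary. [cite: BremnerJozsaShepherdPRSA2011, §2.3] -/
theorem padCirc_toMatrix (C : QCircuit cliffordT N) : (padCirc C).toMatrix 0 = C.toMatrix 0 :=
  gmat_padGates C.gates

/-- The padded circuit of an oracle-free circuit is oracle-free. [folklore] -/
theorem padCirc_isOracleFree {C : QCircuit cliffordT N} (hC : C.IsOracleFree) :
    (padCirc C).IsOracleFree := by
  intro g hg
  simp only [padCirc, padGates, List.mem_flatMap, List.mem_cons, List.mem_append] at hg
  obtain ⟨g', hg', hg⟩ := hg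
  rcases hg with rfl | hg | hg
  · exact hC _ hg'
  · exact isOracleFree_of_mem_hLayerGates hg
  · exact isOracleFree_of_mem_hLayerGates hg

/-! ### Running a Hadamard layer: the emitted operations -/

/-- A run of Hadamard gates on distinct wires emits, for the `i`-th of them, the operation
`CZ (cur wᵢ) (N + k + i)`. [cite: BremnerJozsaShepherdPRSA2011, Thm. 1 (proof, Fig. 1)] -/
theorem ops_run_map_hOn (s : St N) (ws : List (Fin N)) (hws : ws.Nodup) :
    (run s (ws.map hOn)).ops =
      s.ops ++ List.ofFn fun i : Fin ws.length => DOp.CZ (s.cur (ws.get i)) (N + s.k + i) := by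
  induction ws generalizing s with
  | nil => simp
  | cons w ws ih =>
    have hw : w ∉ ws := (List.nodup_cons.1 hws).1
    have hws' : ws.Nodup := (List.nodup_cons.1 hws).2
    have hcur : ∀ i : Fin ws.length, (s.hadamard w).cur (ws[(i : ℕ)]) = s.cur (ws[(i : ℕ)]) :=
      fun i => Function.update_of_ne (fun h => hw (by rw [← h]; exact List.getElem_mem i.isLt)) _ _
    have hk : (s.hadamard w).k = s.k + 1 := rfl
    have hops : (s.hadamard w).ops = s.ops ++ [DOp.CZ (s.cur w) (N + s.k)] := rfl
    rw [List.map_cons, run_cons, step_hOn, ih _ hws', List.ofFn_succ, hk, hops, List.append_assoc,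
      List.singleton_append]
    simp only [hcur, List.get_eq_getElem, List.getElem_cons_zero, List.getElem_cons_succ,
      Fin.val_zero, Fin.val_succ, add_zero, List.cons.injEq, List.append_cancel_left_eq, true_and]
    exact congrArg List.ofFn (funext fun i => by congr 1; omega)

/-- The operations emitted by a full Hadamard layer: `CZ (cur a) (N + k + a)` for every wire
`a`, in order. [cite: BremnerJozsaShepherdPRSA2011, Thm. 1 (proof, Fig. 1)] -/
theorem ops_run_hLayerGates (s : St N) :
    (run s (hLayerGates N)).ops = s.ops ++ List.ofFn fun a : Fin N => DOp.CZ (s.cur a) (N + s.k + a) := by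
  rw [hLayerGates, ops_run_map_hOn s _ (List.nodup_finRange N), List.ofFn_congr List.length_finRange]
  congr 1
  refine congrArg List.ofFn (funext fun a => ?_)
  simp

/-- The full effect of a Hadamard layer on a state: counter, current variables and operations.
[cite: BremnerJozsaShepherdPRSA2011, Thm. 1 (proof, Fig. 1)] -/
theorem run_hLayerGates_eq (s : St N) :
    run s (hLayerGates N) = ⟨s.k + N, fun a => N + s.k + a,
      s.ops ++ List.ofFn fun a : Fin N => DOp.CZ (s.cur a) (N + s.k + a)⟩ := by
  have h1 := k_run_hLayerGates s
  have h2 := cur_run_hLayerGates s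
  have h3 := ops_run_hLayerGates s
  cases hr : run s (hLayerGates N) with
  | mk k cur ops =>
    rw [hr] at h1 h2 h3
    simp only at h1 h2 h3
    rw [h1, h3]
    congr 1
    exact funext h2

/-! ### Based states and the slot of one gate -/

/-- A state is **based** at the counter `k` if every wire `a` has the current variable `k + a`
(as after a full Hadamard layer). [folklore] -/
def Based (s : St N) : Prop := ∀ a : Fin N, s.cur a = s.k + a

/-- After a full Hadamard layer every state is based. [folklore] -/
theorem based_run_hLayerGates (s : St N) : Based (run s (hLayerGates N)) := by
  intro a
  rw [cur_run_hLayerGates, k_run_hLayerGates]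
  omega

/-- The number of fresh variables a gate allocates itself: `1` for `H`, `2` for `CNOT`
(`= H_t CZ H_t`), `0` otherwise. [folklore] -/
def extra : QGate cliffordT N → ℕ
  | .gate .H _ => 1
  | .gate .S _ => 0
  | .gate .T _ => 0
  | .gate .CNOT _ => 2
  | .oracle _ _ => 0

/-- **The operations of a gate in a based slot** with counter `k` (current variable of wire `a`
is `k + a`, the next fresh variable is `N + k`). [cite: BremnerJozsaShepherdPRSA2011, Thm. 1 (proof)] -/
def gateOps (N k : ℕ) : QGate cliffordT N → List DOp
  | .gate .H e => [DOp.CZ (k + embH e 0) (N + k)]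
  | .gate .S e => [DOp.T (k + embS e 0), DOp.T (k + embS e 0)]
  | .gate .T e => [DOp.T (k + embT e 0)]
  | .gate .CNOT e =>
      [DOp.CZ (k + embC e 1) (N + k), DOp.CZ (k + embC e 0) (N + k), DOp.CZ (N + k) (N + k + 1)]
  | .oracle _ _ => []

/-- The current variable of wire `a` right after the gate of a based slot: the gate's last fresh
variable on its target wire, `k + a` elsewhere. [folklore] -/
def gateCur (N k : ℕ) : QGate cliffordT N → Fin N → ℕ
  | .gate .H e, a => if a = embH e 0 then N + k else k + a
  | .gate .S _, a => k + a
  | .gate .T _, a => k + a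
  | .gate .CNOT e, a => if a = embC e 1 then N + k + 1 else k + a
  | .oracle _ _, a => k + a

/-- **The operations of a whole slot** (gate, then two Hadamard layers) in a based state with
counter `k`: the gate's operations, the first layer `CZ (gateCur a) (N + k + e + a)` and the second
layer `CZ (N + k + e + a) (N + k + e + N + a)`, `e = extra g`.
[cite: BremnerJozsaShepherdPRSA2011, Thm. 1 (proof) with §2.3] -/
def slotOps (N k : ℕ) (g : QGate cliffordT N) : List DOp :=
  gateOps N k g ++
    (List.ofFn fun a : Fin N => DOp.CZ (gateCur N k g a) (N + (k + extra g) + a)) ++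
    (List.ofFn fun a : Fin N => DOp.CZ (N + (k + extra g) + a) (N + (k + extra g + N) + a))

/-- The rewriting step of a gate on a based state, explicitly. [folklore] -/
theorem step_based {s : St N} (hs : Based s) (g : QGate cliffordT N) :
    HGadget.step s g = ⟨s.k + extra g, gateCur N s.k g, s.ops ++ gateOps N s.k g⟩ := by
  obtain ⟨k, cur, ops⟩ := s
  have hcur : cur = fun a : Fin N => k + (a : ℕ) := funext hs
  subst hcur
  cases g with
  | oracle k' e =>
    simp only [HGadget.step, extra, gateOps, add_zero, List.append_nil, St.mk.injEq, true_and, and_true]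
    funext a; rfl
  | gate g e =>
    cases g with
    | H =>
      simp only [HGadget.step, St.hadamard, extra, gateOps, St.mk.injEq, true_and]
      refine ⟨funext fun a => ?_, trivial⟩
      simp only [gateCur, Function.update_apply]
    | S =>
      simp only [HGadget.step, St.emit, extra, gateOps, add_zero, St.mk.injEq, true_and, and_true]
      funext a; rfl
    | T =>
      simp only [HGadget.step, St.emit, extra, gateOps, add_zero, St.mk.injEq, true_and, and_true]
      funext a; rfl
    | CNOT =>
      have hne : embC e 0 ≠ embC e 1 := emb_two_ne (embC e)
      have h1 : ∀ (f : Fin N → ℕ) (v : ℕ), Function.update f (embC e 1) v (embC e 0) = f (embC e 0) :=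
        fun f v => Function.update_of_ne hne _ _
      simp only [HGadget.step, St.hadamard, St.emit, extra, gateOps, St.mk.injEq, h1,
        Function.update_self, List.append_assoc, List.cons_append, List.nil_append]
      refine ⟨trivial, funext fun a => ?_, ?_⟩
      · simp only [gateCur]
        by_cases ha : a = embC e 1
        · subst ha
          simp only [Function.update_self, if_true]
          omega
        · simp [ha]
      · simp [Nat.add_assoc]

/-- **One slot**: from a based state, the gate followed by the two Hadamard layers leads to the
based state with counter `k + extra g + 2N` and the operations `slotOps N k g` appended.
[cite: BremnerJozsaShepherdPRSA2011, Thm. 1 (proof) with §2.3] -/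
theorem run_slot {s : St N} (hs : Based s) (g : QGate cliffordT N) :
    run s (g :: (hLayerGates N ++ hLayerGates N)) =
      ⟨s.k + extra g + N + N, fun a => (s.k + extra g + N + N) + a, s.ops ++ slotOps N s.k g⟩ := by
  rw [run_cons, run_append, step_based hs, run_hLayerGates_eq, run_hLayerGates_eq]
  simp only [slotOps, List.append_assoc, St.mk.injEq, and_true, true_and]
  funext a
  omega

/-! ### The closed form of the gadget operations of the padded circuit -/

/-- The counter after the slots of `gs`, starting from `k`. [folklore] -/
def padKFrom (N : ℕ) : ℕ → List (QGate cliffordT N) → ℕ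
  | k, [] => k
  | k, g :: gs => padKFrom N (k + extra g + N + N) gs

/-- **The operations of the slots of `gs`**, starting from the counter `k` (closed form of the
gadget rewriting of the padded gate list from a based state).
[cite: BremnerJozsaShepherdPRSA2011, Thm. 1 (proof)] -/
def padOpsFrom (N : ℕ) : ℕ → List (QGate cliffordT N) → List DOp
  | _, [] => []
  | k, g :: gs => slotOps N k g ++ padOpsFrom N (k + extra g + N + N) gs

/-- Running the padded gates from a based state. [cite: BremnerJozsaShepherdPRSA2011, Thm. 1 (proof)] -/
theorem run_padGates {s : St N} (hs : Based s) (gs : List (QGate cliffordT N)) :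
    run s (padGates gs) =
      ⟨padKFrom N s.k gs, fun a => padKFrom N s.k gs + a, s.ops ++ padOpsFrom N s.k gs⟩ := by
  induction gs generalizing s with
  | nil =>
    obtain ⟨k, cur, ops⟩ := s
    have hcur : cur = fun a : Fin N => k + (a : ℕ) := funext hs
    subst hcur
    simp [padGates, padKFrom, padOpsFrom]
  | cons g gs ih =>
    rw [padGates_cons, run_append, run_slot hs, ih (fun a => rfl)]
    simp [padKFrom, padOpsFrom, List.append_assoc]

/-- The operations of the first Hadamard layer from the initial state: `CZ a (N + a)`. [folklore] -/
def initOps (N : ℕ) : List DOp := List.ofFn fun a : Fin N => DOp.CZ a (N + a)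

/-- The operations of the final Hadamard layer from the based state with counter `K₁`:
`CZ (K₁ + a) (N + K₁ + a)`. [folklore] -/
def lastOps (N K : ℕ) : List DOp := List.ofFn fun a : Fin N => DOp.CZ (K + a) (N + K + a)

/-- `K₁` of the padded circuit in closed form. [folklore] -/
theorem preCount_padCirc (C : QCircuit cliffordT N) : preCount (padCirc C) = padKFrom N N C.gates := by
  rw [preCount, preState, run_append, show (padCirc C).gates = padGates C.gates from rfl,
    run_padGates (based_run_hLayerGates (St.init N)), k_run_hLayerGates]
  simp [St.init]

/-- **The gadget operations of the padded circuit in closed form**: first layer, slots, last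
layer. [cite: BremnerJozsaShepherdPRSA2011, Thm. 1 (proof)] -/
theorem ops_sfinal_padCirc (C : QCircuit cliffordT N) :
    (sfinal (padCirc C)).ops = initOps N ++ padOpsFrom N N C.gates ++ lastOps N (padKFrom N N C.gates) := by
  rw [sfinal_eq, preState, run_append, show (padCirc C).gates = padGates C.gates from rfl,
    run_padGates (based_run_hLayerGates (St.init N)), run_hLayerGates_eq, k_run_hLayerGates,
    ops_run_hLayerGates]
  simp only [St.init, zero_add, add_zero, List.nil_append, initOps, lastOps]

/-! ### The padded family -/

section Family

variable (F : QCircuitFamily cliffordT)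

/-- The family of padded circuits of `F` (same ancillas). [cite: BremnerJozsaShepherdPRSA2011, §2.3] -/
def padFamily : QCircuitFamily cliffordT where
  ancillas := F.ancillas
  circ n := padCirc (F.circ n)

/-- The padded family of an oracle-free family is oracle-free. [folklore] -/
theorem padFamily_isOracleFree (hF : F.IsOracleFree) : (padFamily F).IsOracleFree :=
  fun n => padCirc_isOracleFree (hF n)

/-- Padding does not change post-selection probabilities. [folklore] -/
theorem postselectProbOn_padFamily (x : List Bool) :
    (padFamily F).postselectProbOn 0 x = F.postselectProbOn 0 x := by
  show (padCirc (F.circ x.length)).postselectProb 0 x.get = (F.circ x.length).postselectProb 0 x.get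
  unfold QCircuit.postselectProb QCircuit.probEvent QCircuit.runOn
  rw [padCirc_toMatrix]

/-- Padding does not change joint acceptance probabilities. [folklore] -/
theorem jointAcceptProbOn_padFamily (x : List Bool) :
    (padFamily F).jointAcceptProbOn 0 x = F.jointAcceptProbOn 0 x := by
  show (padCirc (F.circ x.length)).jointAcceptProb 0 x.get = (F.circ x.length).jointAcceptProb 0 x.get
  unfold QCircuit.jointAcceptProb QCircuit.probEvent QCircuit.runOn
  rw [padCirc_toMatrix]

/-- Padding does not change conditional acceptance probabilities. [folklore] -/
theorem condAcceptProbOn_padFamily (x : List Bool) :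
    (padFamily F).condAcceptProbOn 0 x = F.condAcceptProbOn 0 x := by
  show (padFamily F).jointAcceptProbOn 0 x / (padFamily F).postselectProbOn 0 x =
    F.jointAcceptProbOn 0 x / F.postselectProbOn 0 x
  rw [postselectProbOn_padFamily, jointAcceptProbOn_padFamily]

/-- The padded family decides under post-selection exactly what `F` decides. [folklore] -/
theorem postConditions_padFamily {L : Language Bool} {ε : ℝ}
    (h : ∀ x, 0 < F.postselectProbOn 0 x ∧
      (x ∈ L → 1 - ε ≤ F.condAcceptProbOn 0 x) ∧ (x ∉ L → F.condAcceptProbOn 0 x ≤ ε)) :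
    ∀ x, 0 < (padFamily F).postselectProbOn 0 x ∧
      (x ∈ L → 1 - ε ≤ (padFamily F).condAcceptProbOn 0 x) ∧
      (x ∉ L → (padFamily F).condAcceptProbOn 0 x ≤ ε) := by
  intro x
  rw [postselectProbOn_padFamily, condAcceptProbOn_padFamily]
  exact h x

end Family

/-- **The Hadamard gadget reduction, up to the uniformity of the padded gadget family.** If for
every uniform oracle-free Clifford+`T` family `F` the gadget family of its padded family is
uniform, then `PostBQPWith ε ⊆ PostIQPWith ε` for every `ε`
(`PostBQPWith_subset_PostIQPWith`). [cite: BremnerJozsaShepherdPRSA2011, Thm. 1 (proof)] -/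
theorem PostBQPWith_subset_PostIQPWith_of_padGadgetUniform
    (hU : ∀ F : QCircuitFamily cliffordT, F.IsOracleFree → F.IsUniform →
      (gadgetFamily (padFamily F)).IsUniform) :
    PostBQPWith_subset_PostIQPWith := by
  rintro ε L ⟨F, hF, hFu, h⟩
  exact mem_PostIQPWith_of_gadgetFamily (padFamily F) (padFamily_isOracleFree F hF) (hU F hF hFu)
    (postConditions_padFamily F h)

end HGadget

end Literature.Computability.QuantumComplexity
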